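import Mathlib.Analysis.Calculus.MeanValue
import Mathlib.Analysis.Calculus.Deriv.Inv
import Mathlib.Analysis.Calculus.Deriv.Pow
import Mathlib.Analysis.Real.Sqrt
import Literature.MathematicalPhysics.StatisticalMechanics.Crystallization
import Summits.AtomisticToContinuum.Crystallization.Theorems.NashClassCertificatesNashTwoShellGapSiteStability

/-!
# Crux `PeriodicWindows` (stmt-AtomisticToContinuum-3240), line `dense-laminar-hull` — stub `hc_phiTaylor`
# One-variable Taylor bounds for `f(x) = (1/12) x⁻⁶ − (1/6) x⁻³ = V_LJ(√x)`

With `x = H² + ‖u‖²` every term of the general-offset layer interaction is `f(x) := (1/12) x⁻⁶ − (1/6) x⁻³`,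
and `f(x) = V_LJ(√x)` for `x ≥ 0` (`hcp_lennardJones_sqrt`). We prove the Taylor bounds of `f` of order one
and two on `[m, ∞)` (`m > 0`), with the derivatives
`f'(x) = −(1/2) x⁻⁷ + (1/2) x⁻⁴`, `f''(x) = (7/2) x⁻⁸ − 2 x⁻⁵`, `f'''(x) = −28 x⁻⁹ + 10 x⁻⁶`:

* `|f(y) − f(x) − f'(x)(y − x)| ≤ K₂(m) (y − x)²`, `K₂(m) = (7/2) m⁻⁸ + 2 m⁻⁵ ≥ sup_{[m,∞)} |f''|`;
* `|f(y) − f(x) − f'(x)(y − x) − ½ f''(x)(y − x)²| ≤ K₃(m) |y − x|³`, `K₃(m) = 28 m⁻⁹ + 10 m⁻⁶ ≥ sup_{[m,∞)} |f'''|`.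

The derivatives `f'` and `f''` are the landed `NashTwoShellGapForceBalance.hasDerivAt_profile` and
`NashTwoShellGapSiteStability.hasDerivAt_profileDeriv` (same radial profile `W = f`); `f'''` is computed here
(`hcp_f''_hasDerivAt`).

Route: two applications of the one-dimensional mean value inequality
(`Convex.norm_image_sub_le_of_norm_hasDerivWithin_le`): a derivative bound `|φ'| ≤ C` on `[m, ∞)` makes `φ`
`C`-Lipschitz there (`hcp_lipschitz_of_deriv_bound`); if `φ'` is `K`-Lipschitz then
`g(t) = φ(t) − φ(x) − φ'(x)(t − x)` has `|g'| ≤ K |y − x|` on the segment `[x, y]` and vanishes at `x`, whence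
`|g(y)| ≤ K (y − x)²` (`hcp_taylor_one`); feeding the order-one bound for `φ'` into the same argument gives the
order-two bound with constant `sup |φ'''|` (`hcp_taylor_two`). All elementary. [folklore]
-/

noncomputable section

namespace Summit.AtomisticToContinuum.Crystallization.Theorems.PeriodicWindowsDenseLaminarHull

open Literature.MathematicalPhysics.StatisticalMechanics Filter Metric
open scoped BigOperators

/-! ## Part 0: `V_LJ(√x) = f(x)` -/

/-- `V_LJ(√x) = (1/12) x⁻⁶ − (1/6) x⁻³` for `x ≥ 0` (`(√x)⁻¹² = ((√x)²)⁻⁶ = x⁻⁶`). [folklore] -/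
theorem hcp_lennardJones_sqrt (x : ℝ) (hx : 0 ≤ x) :
    lennardJones (Real.sqrt x) = (1 / 12) * (x⁻¹) ^ 6 - (1 / 6) * (x⁻¹) ^ 3 := by
  have h2 : (Real.sqrt x)⁻¹ ^ 2 = x⁻¹ := by rw [inv_pow, Real.sq_sqrt hx]
  have h12 : (Real.sqrt x)⁻¹ ^ 12 = (x⁻¹) ^ 6 := by
    rw [← h2, ← pow_mul]
  have h6 : (Real.sqrt x)⁻¹ ^ 6 = (x⁻¹) ^ 3 := by
    rw [← h2, ← pow_mul]
  unfold lennardJones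
  rw [h12, h6]

/-! ## Derivatives of inverse powers -/

/-- `d/dt (t⁻¹)ⁿ = −n (t⁻¹)ⁿ⁺¹` at `t = x ≠ 0`. [folklore] -/
theorem hcp_hasDerivAt_inv_pow {x : ℝ} (hx : x ≠ 0) (n : ℕ) :
    HasDerivAt (fun t : ℝ => (t⁻¹) ^ n) (-(n : ℝ) * (x⁻¹) ^ (n + 1)) x := by
  refine ((hasDerivAt_inv hx).fun_pow n).congr_deriv ?_
  cases n with
  | zero => simp
  | succ k =>
    rw [Nat.add_sub_cancel, ← inv_pow]
    push_cast
    ring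

/-- `f'''`: `d/dt [(7/2) t⁻⁸ − 2 t⁻⁵] = −28 t⁻⁹ + 10 t⁻⁶` at `t = x ≠ 0`. [folklore] -/
theorem hcp_f''_hasDerivAt {x : ℝ} (hx : x ≠ 0) :
    HasDerivAt (fun t : ℝ => (7 / 2) * (t⁻¹) ^ 8 - 2 * (t⁻¹) ^ 5)
      (-28 * (x⁻¹) ^ 9 + 10 * (x⁻¹) ^ 6) x := by
  refine (((hcp_hasDerivAt_inv_pow hx 8).const_mul (7 / 2)).sub
    ((hcp_hasDerivAt_inv_pow hx 5).const_mul 2)).congr_deriv ?_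
  push_cast
  ring

/-! ## Sup bounds for `f''` and `f'''` on `[m, ∞)` -/

/-- `|f''(t)| ≤ (7/2) m⁻⁸ + 2 m⁻⁵` for `t ≥ m > 0`. [folklore] -/
theorem hcp_f''_bound {m t : ℝ} (hm : 0 < m) (ht : m ≤ t) :
    |(7 / 2 : ℝ) * (t⁻¹) ^ 8 - 2 * (t⁻¹) ^ 5| ≤ (7 / 2) * (m⁻¹) ^ 8 + 2 * (m⁻¹) ^ 5 := by
  have ht0 : 0 ≤ t⁻¹ := inv_nonneg.mpr (hm.le.trans ht)
  have hle : t⁻¹ ≤ m⁻¹ := inv_anti₀ hm ht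
  have h8 : (t⁻¹) ^ 8 ≤ (m⁻¹) ^ 8 := pow_le_pow_left₀ ht0 hle 8
  have h5 : (t⁻¹) ^ 5 ≤ (m⁻¹) ^ 5 := pow_le_pow_left₀ ht0 hle 5
  have h8' : 0 ≤ (t⁻¹) ^ 8 := pow_nonneg ht0 8
  have h5' : 0 ≤ (t⁻¹) ^ 5 := pow_nonneg ht0 5
  rw [abs_le]
  constructor <;> linarith

/-- `|f'''(t)| ≤ 28 m⁻⁹ + 10 m⁻⁶` for `t ≥ m > 0`. [folklore] -/
theorem hcp_f'''_bound {m t : ℝ} (hm : 0 < m) (ht : m ≤ t) :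
    |(-28 : ℝ) * (t⁻¹) ^ 9 + 10 * (t⁻¹) ^ 6| ≤ 28 * (m⁻¹) ^ 9 + 10 * (m⁻¹) ^ 6 := by
  have ht0 : 0 ≤ t⁻¹ := inv_nonneg.mpr (hm.le.trans ht)
  have hle : t⁻¹ ≤ m⁻¹ := inv_anti₀ hm ht
  have h9 : (t⁻¹) ^ 9 ≤ (m⁻¹) ^ 9 := pow_le_pow_left₀ ht0 hle 9
  have h6 : (t⁻¹) ^ 6 ≤ (m⁻¹) ^ 6 := pow_le_pow_left₀ ht0 hle 6
  have h9' : 0 ≤ (t⁻¹) ^ 9 := pow_nonneg ht0 9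
  have h6' : 0 ≤ (t⁻¹) ^ 6 := pow_nonneg ht0 6
  rw [abs_le]
  constructor <;> linarith

/-! ## Mean value inequalities on `[m, ∞)` -/

/-- A derivative bound `|φ'| ≤ C` on `[m, ∞)` makes `φ` `C`-Lipschitz there (mean value inequality on the
convex set `[m, ∞)`). [folklore] -/
theorem hcp_lipschitz_of_deriv_bound {φ φ' : ℝ → ℝ} {m C : ℝ}
    (hd : ∀ t, m ≤ t → HasDerivAt φ (φ' t) t) (hb : ∀ t, m ≤ t → |φ' t| ≤ C)
    {x y : ℝ} (hx : m ≤ x) (hy : m ≤ y) : |φ y - φ x| ≤ C * |y - x| := by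
  have h := (convex_Ici m).norm_image_sub_le_of_norm_hasDerivWithin_le
    (f := φ) (f' := φ') (x := x) (y := y) (C := C)
    (fun t ht => (hd t ht).hasDerivWithinAt)
    (fun t ht => by simpa only [Real.norm_eq_abs] using hb t ht) hx hy
  simpa only [Real.norm_eq_abs] using h

/-- Points of the segment `[x, y]` with `x, y ≥ m` are `≥ m`. [folklore] -/
theorem hcp_le_of_mem_uIcc {m x y t : ℝ} (hx : m ≤ x) (hy : m ≤ y) (ht : t ∈ Set.uIcc x y) : m ≤ t := by
  rcases Set.mem_uIcc.mp ht with ⟨h1, _⟩ | ⟨h1, _⟩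
  · exact hx.trans h1
  · exact hy.trans h1

/-- **Order-one Taylor bound**: if `φ'` is `K`-Lipschitz on `[m, ∞)` then
`|φ(y) − φ(x) − φ'(x)(y − x)| ≤ K (y − x)²` for `x, y ≥ m` (mean value inequality applied to
`t ↦ φ(t) − φ(x) − φ'(x)(t − x)` on the segment `[x, y]`, where its derivative `φ'(t) − φ'(x)` is bounded by
`K |y − x|`). [folklore] -/
theorem hcp_taylor_one {φ φ' : ℝ → ℝ} {m K : ℝ} (hK : 0 ≤ K)
    (hd : ∀ t, m ≤ t → HasDerivAt φ (φ' t) t)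
    (hlip : ∀ x t, m ≤ x → m ≤ t → |φ' t - φ' x| ≤ K * |t - x|)
    {x y : ℝ} (hx : m ≤ x) (hy : m ≤ y) :
    |φ y - φ x - φ' x * (y - x)| ≤ K * (y - x) ^ 2 := by
  have hgd : ∀ t, m ≤ t →
      HasDerivAt (fun t => φ t - φ x - φ' x * (t - x)) (φ' t - φ' x) t := by
    intro t ht
    refine (((hd t ht).sub_const (φ x)).sub
      (((hasDerivAt_id' t).sub_const x).const_mul (φ' x))).congr_deriv ?_
    ring
  have key := (convex_uIcc x y).norm_image_sub_le_of_norm_hasDerivWithin_le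
    (f := fun t => φ t - φ x - φ' x * (t - x)) (f' := fun t => φ' t - φ' x) (C := K * |y - x|)
    (x := x) (y := y)
    (fun t ht => (hgd t (hcp_le_of_mem_uIcc hx hy ht)).hasDerivWithinAt)
    (fun t ht => by
      rw [Real.norm_eq_abs]
      calc |φ' t - φ' x| ≤ K * |t - x| := hlip x t hx (hcp_le_of_mem_uIcc hx hy ht)
        _ ≤ K * |y - x| := mul_le_mul_of_nonneg_left (Set.abs_sub_left_of_mem_uIcc ht) hK)
    Set.left_mem_uIcc Set.right_mem_uIcc
  have hsq : |y - x| * |y - x| = (y - x) ^ 2 := by rw [abs_mul_abs_self, sq]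
  simp only [sub_self, mul_zero, sub_zero, Real.norm_eq_abs] at key
  calc |φ y - φ x - φ' x * (y - x)| ≤ K * |y - x| * |y - x| := key
    _ = K * (y - x) ^ 2 := by rw [mul_assoc, hsq]

/-- **Order-two Taylor bound**: if `|φ'(t) − φ'(x) − φ''(x)(t − x)| ≤ K (t − x)²` on `[m, ∞)` then
`|φ(y) − φ(x) − φ'(x)(y − x) − ½ φ''(x)(y − x)²| ≤ K |y − x|³` for `x, y ≥ m` (mean value inequality applied
to `t ↦ φ(t) − φ(x) − φ'(x)(t − x) − ½ φ''(x)(t − x)²` on the segment `[x, y]`, where its derivative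
`φ'(t) − φ'(x) − φ''(x)(t − x)` is bounded by `K (y − x)²`). [folklore] -/
theorem hcp_taylor_two {φ φ' φ'' : ℝ → ℝ} {m K : ℝ} (hK : 0 ≤ K)
    (hd : ∀ t, m ≤ t → HasDerivAt φ (φ' t) t)
    (h1 : ∀ x t, m ≤ x → m ≤ t → |φ' t - φ' x - φ'' x * (t - x)| ≤ K * (t - x) ^ 2)
    {x y : ℝ} (hx : m ≤ x) (hy : m ≤ y) :
    |φ y - φ x - φ' x * (y - x) - 1 / 2 * φ'' x * (y - x) ^ 2| ≤ K * |y - x| ^ 3 := by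
  have hgd : ∀ t, m ≤ t →
      HasDerivAt (fun t => φ t - φ x - φ' x * (t - x) - 1 / 2 * φ'' x * (t - x) ^ 2)
        (φ' t - φ' x - φ'' x * (t - x)) t := by
    intro t ht
    refine ((((hd t ht).sub_const (φ x)).sub (((hasDerivAt_id' t).sub_const x).const_mul (φ' x))).sub
      ((((hasDerivAt_id' t).sub_const x).fun_pow 2).const_mul (1 / 2 * φ'' x))).congr_deriv ?_
    simp only [Nat.cast_ofNat, Nat.reduceSub, pow_one, mul_one]
    ring
  have key := (convex_uIcc x y).norm_image_sub_le_of_norm_hasDerivWithin_le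
    (f := fun t => φ t - φ x - φ' x * (t - x) - 1 / 2 * φ'' x * (t - x) ^ 2)
    (f' := fun t => φ' t - φ' x - φ'' x * (t - x)) (C := K * (y - x) ^ 2)
    (x := x) (y := y)
    (fun t ht => (hgd t (hcp_le_of_mem_uIcc hx hy ht)).hasDerivWithinAt)
    (fun t ht => by
      rw [Real.norm_eq_abs]
      calc |φ' t - φ' x - φ'' x * (t - x)| ≤ K * (t - x) ^ 2 := h1 x t hx (hcp_le_of_mem_uIcc hx hy ht)
        _ ≤ K * (y - x) ^ 2 :=
          mul_le_mul_of_nonneg_left (sq_le_sq.mpr (Set.abs_sub_left_of_mem_uIcc ht)) hK)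
    Set.left_mem_uIcc Set.right_mem_uIcc
  have hsq : (y - x) ^ 2 * |y - x| = |y - x| ^ 3 := by rw [← sq_abs]; ring
  simp only [sub_self, mul_zero, sub_zero, ne_eq, OfNat.ofNat_ne_zero, not_false_eq_true, zero_pow,
    Real.norm_eq_abs] at key
  calc |φ y - φ x - φ' x * (y - x) - 1 / 2 * φ'' x * (y - x) ^ 2| ≤ K * (y - x) ^ 2 * |y - x| := key
    _ = K * |y - x| ^ 3 := by rw [mul_assoc, hsq]

/-! ## The stub -/

/-- **Stub `hc_phiTaylor`** (line `dense-laminar-hull`, wave 1): with `f(x) = (1/12) x⁻⁶ − (1/6) x⁻³` one has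
`V_LJ(√x) = f(x)` for `x ≥ 0`, and for `x, y ≥ m > 0` the Taylor bounds
`|f(y) − f(x) − f'(x)(y − x)| ≤ ((7/2) m⁻⁸ + 2 m⁻⁵)(y − x)²` and
`|f(y) − f(x) − f'(x)(y − x) − ½ f''(x)(y − x)²| ≤ (28 m⁻⁹ + 10 m⁻⁶)|y − x|³`, the constants being
`sup_{[m,∞)} |f''|` and `sup_{[m,∞)} |f'''|` (two applications of the mean value inequality). [folklore] -/
theorem hc_phiTaylor : (∀ x : ℝ, 0 ≤ x → lennardJones (Real.sqrt x) = (1 / 12) * (x⁻¹) ^ 6 - (1 / 6) * (x⁻¹) ^ 3) ∧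
    ∀ x y m : ℝ, 0 < m → m ≤ x → m ≤ y →
    |((1 / 12 : ℝ) * (y⁻¹) ^ 6 - (1 / 6) * (y⁻¹) ^ 3) - ((1 / 12) * (x⁻¹) ^ 6 - (1 / 6) * (x⁻¹) ^ 3) -
        (-(1 / 2) * (x⁻¹) ^ 7 + (1 / 2) * (x⁻¹) ^ 4) * (y - x)| ≤
      ((7 / 2) * (m⁻¹) ^ 8 + 2 * (m⁻¹) ^ 5) * (y - x) ^ 2 ∧
    |((1 / 12 : ℝ) * (y⁻¹) ^ 6 - (1 / 6) * (y⁻¹) ^ 3) - ((1 / 12) * (x⁻¹) ^ 6 - (1 / 6) * (x⁻¹) ^ 3) -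
        (-(1 / 2) * (x⁻¹) ^ 7 + (1 / 2) * (x⁻¹) ^ 4) * (y - x) -
        (1 / 2) * ((7 / 2) * (x⁻¹) ^ 8 - 2 * (x⁻¹) ^ 5) * (y - x) ^ 2| ≤
      (28 * (m⁻¹) ^ 9 + 10 * (m⁻¹) ^ 6) * |y - x| ^ 3 := by
  refine ⟨hcp_lennardJones_sqrt, fun x y m hm hx hy => ?_⟩
  have hne : ∀ t, m ≤ t → t ≠ 0 := fun t ht => (hm.trans_le ht).ne'
  -- derivatives on `[m, ∞)`
  have hd0 : ∀ t, m ≤ t → HasDerivAt (fun t : ℝ => (1 / 12) * (t⁻¹) ^ 6 - (1 / 6) * (t⁻¹) ^ 3)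
      (-(1 / 2) * (t⁻¹) ^ 7 + (1 / 2) * (t⁻¹) ^ 4) t := fun t ht =>
    NashTwoShellGapForceBalance.hasDerivAt_profile (hne t ht)
  have hd1 : ∀ t, m ≤ t → HasDerivAt (fun t : ℝ => -(1 / 2) * (t⁻¹) ^ 7 + (1 / 2) * (t⁻¹) ^ 4)
      ((7 / 2) * (t⁻¹) ^ 8 - 2 * (t⁻¹) ^ 5) t := fun t ht =>
    NashTwoShellGapSiteStability.hasDerivAt_profileDeriv (hne t ht)
  have hd2 : ∀ t, m ≤ t → HasDerivAt (fun t : ℝ => (7 / 2) * (t⁻¹) ^ 8 - 2 * (t⁻¹) ^ 5)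
      (-28 * (t⁻¹) ^ 9 + 10 * (t⁻¹) ^ 6) t := fun t ht => hcp_f''_hasDerivAt (hne t ht)
  -- Lipschitz bounds for `f'` and `f''`
  have hlip1 : ∀ x t : ℝ, m ≤ x → m ≤ t →
      |(-(1 / 2) * (t⁻¹) ^ 7 + (1 / 2) * (t⁻¹) ^ 4) - (-(1 / 2) * (x⁻¹) ^ 7 + (1 / 2) * (x⁻¹) ^ 4)| ≤
        ((7 / 2) * (m⁻¹) ^ 8 + 2 * (m⁻¹) ^ 5) * |t - x| := fun x t hx ht =>
    hcp_lipschitz_of_deriv_bound hd1 (fun t ht => hcp_f''_bound hm ht) hx ht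
  have hlip2 : ∀ x t : ℝ, m ≤ x → m ≤ t →
      |((7 / 2) * (t⁻¹) ^ 8 - 2 * (t⁻¹) ^ 5) - ((7 / 2) * (x⁻¹) ^ 8 - 2 * (x⁻¹) ^ 5)| ≤
        (28 * (m⁻¹) ^ 9 + 10 * (m⁻¹) ^ 6) * |t - x| := fun x t hx ht =>
    hcp_lipschitz_of_deriv_bound hd2 (fun t ht => hcp_f'''_bound hm ht) hx ht
  have hK2 : (0 : ℝ) ≤ (7 / 2) * (m⁻¹) ^ 8 + 2 * (m⁻¹) ^ 5 := by positivity
  have hK3 : (0 : ℝ) ≤ 28 * (m⁻¹) ^ 9 + 10 * (m⁻¹) ^ 6 := by positivity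
  refine ⟨hcp_taylor_one hK2 hd0 hlip1 hx hy, ?_⟩
  -- order-one bound for `f'` with constant `K₃`, then the order-two bound for `f`
  have h1 : ∀ x t : ℝ, m ≤ x → m ≤ t →
      |(-(1 / 2) * (t⁻¹) ^ 7 + (1 / 2) * (t⁻¹) ^ 4) - (-(1 / 2) * (x⁻¹) ^ 7 + (1 / 2) * (x⁻¹) ^ 4) -
          ((7 / 2) * (x⁻¹) ^ 8 - 2 * (x⁻¹) ^ 5) * (t - x)| ≤
        (28 * (m⁻¹) ^ 9 + 10 * (m⁻¹) ^ 6) * (t - x) ^ 2 := fun x t hx ht =>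
    hcp_taylor_one hK3 hd1 hlip2 hx ht
  exact hcp_taylor_two hK3 hd0 h1 hx hy

end Summit.AtomisticToContinuum.Crystallization.Theorems.PeriodicWindowsDenseLaminarHull

end
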